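import Literature.Barriers.AtomisticToContinuum.DisorderedHarmonicChainPointwiseU
import Literature.Barriers.AtomisticToContinuum.DisorderedHarmonicChainPositivity
import Literature.Barriers.AtomisticToContinuum.DisorderedHarmonicChainResonantL
import Literature.Barriers.AtomisticToContinuum.DisorderedHarmonicChainTransfer
import HarnessLib

/-!
# Discharges of named facts of `DisorderedHarmonicChainSpectral.lean`

`Literature/Barriers/AtomisticToContinuum/DisorderedHarmonicChainSpectralHolds.lean` —
proofs-only sibling of `DisorderedHarmonicChainSpectral.lean` (no definitions, no named
facts). Each theorem below closes a named fact `X : Prop` of that file as `X_holds : X` by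
composing an ACCEPTED reduction theorem of the tree with the ACCEPTED unconditional `_holds`
discharges of all of its hypotheses; nothing is re-proved and no statement is changed.
Recorded by the librarian sweep g25 (2026-08-16, pass 5c: facts dischargeable in one line from
the tree's own lemmas), so that the facts census, `#h21_route_deps` and the cone guardrail see
these facts as theorems.

Discharged here:

* `AjankiHuveneers2011_spectralScaling_holds` :=
  `AjankiHuveneers2011_spectralScaling_of_bounds`
  `AjankiHuveneers2011_lowFrequencyBound_holds` `AjankiHuveneers2011_highFrequencyBound_holds`
  `AjankiHuveneers2011_criticalBandLowerBound_holds` (`DisorderedHarmonicChainTransfer.lean`).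

## References

* [AjankiHuveneers2011] — see `lean/references.bib` and the docstring of the fact in `DisorderedHarmonicChainSpectral.lean`.
-/

namespace Literature.Barriers.AtomisticToContinuum

/-- **Discharge of the named fact `AjankiHuveneers2011_spectralScaling`**
(`DisorderedHarmonicChainSpectral.lean`): (F2) Ajanki–Huveneers 2011, Theorem 1.1, in the
transmission-integral form in which it is proved (§2.1 (2.6)–(2.7) and §6; the high-frequency
part of the upper bound from O'Connor 1975, Thm 6): if the masses are i.i.d. … — obtained as
`AjankiHuveneers2011_spectralScaling_of_bounds` applied to the tree's unconditional discharges
`AjankiHuveneers2011_lowFrequencyBound_holds`, `AjankiHuveneers2011_highFrequencyBound_holds`,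
`AjankiHuveneers2011_criticalBandLowerBound_holds` of its hypotheses (reduction in
`DisorderedHarmonicChainTransfer.lean`).
[cite: AjankiHuveneers2011, Thm 1.1 with §2.1 eqs. (2.5)-(2.7) and §6] -/
theorem AjankiHuveneers2011_spectralScaling_holds :
    AjankiHuveneers2011_spectralScaling :=
  AjankiHuveneers2011_spectralScaling_of_bounds
    AjankiHuveneers2011_lowFrequencyBound_holds
    AjankiHuveneers2011_highFrequencyBound_holds
    AjankiHuveneers2011_criticalBandLowerBound_holds

end Literature.Barriers.AtomisticToContinuum
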